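import Summits.BirchSwinnertonDyer.BirchSwinnertonDyer.Theorems.SignedLowerHalvesSmallImageLowerHalfBothSignsLambdaLowerThreeNsThetaPartnerSharpExport
import Summits.BirchSwinnertonDyer.BirchSwinnertonDyer.Theorems.ResidualThetaTransportAtTwoHeckeThetaPartnerAdicAtTwoTeichmullerTwist
import Summits.BirchSwinnertonDyer.BirchSwinnertonDyer.Theorems.ResidualThetaTransportAtTwoHeckeThetaPartnerAdicAtTwoTypeOneGrossencharakter
import Literature.NumberTheory.GaloisRepresentations.GrossencharakterConductor
import Literature.NumberTheory.GaloisRepresentations.HeckeCharacterWeakApproximation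
import Literature.NumberTheory.Automorphic.BCDTModularity
import HarnessLib

/-!
# STUB-PLAN `stub_modThree` (stub critic gen 2) — companion: the E4 / E4′ ramification-transfer sub-lemmas of E3, TYPED

Crux `FreyModularity` (stmt-ABC-11340), line `Lines/Sketch.lean`, stub `stub_modThree`.  The two `sorry`s ARE the helpers (to be proved in
`Summits/ABC/ABC/Theorems/DefiniteXiFreyModularityModThreeCMTransfer.lean`); see `STUB-PLAN-stub_modThree.md` §2 E4/E4′ for the proof sketch.
E0–E3, E5 are typed in `STUB_IDEAS_stub_modThree_1_g10.lean` (same directory).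
-/

set_option autoImplicit false
set_option linter.dupNamespace false
noncomputable section

open scoped Classical NumberField MatrixGroups Polynomial
open IsDedekindDomain IsDedekindDomain.HeightOneSpectrum Field Matrix NumberField Polynomial
open Literature.NumberTheory.EllipticCurves
open Literature.NumberTheory.GaloisRepresentations Literature.NumberTheory.LFunctions
open Literature.NumberTheory.Automorphic

namespace Summit.ABC.ABC.Cruxes.FreyModularity.Sketch.StubCriticModThreeG2

/-- **E4** (M; the ramification-transfer sub-lemma of E3 step (7)).  `ψ` a Grössencharakter mod `𝔪 ∋ 3` of type
`(1,0)`, `η` a Hecke character with `η ^ 8 = 1` (the Teichmüller lift of `ρ̄|_{G_K}`), `ψ ≡ η` (3-adically, via `e`) OFF `𝔪`,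
`χ` a Hecke character realising `ψ` off `𝔪`.  Then at every finite place `w ∤ 3` where `χ` is unramified, `η` is unramified
too and `χ(ϖ_w) ≡ η(ϖ_w)` — ALSO for `w ∣ 𝔪` (the case primitivisation in E5 needs).  Proof: `ψ₁ := χ * η⁻¹`; by weak
approximation (`b ≡ u (mod w^c)`, `b ≡ 1 (mod 𝔪' · 3^N)` at the other bad places) `ψ₁,w|_{𝓞_w^×}` and `ψ₁,w(ϖ_w)` are
`≡ 1 (mod 𝔓)` (every other local factor is `≡ 1`: congruence off `𝔪`, `σ(b) ≡ 1 (mod 3^N)` at infinity type `(1,0)`),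
of finite order on units ⇒ `3`-power order; `η_w|_{𝓞_w^×} = ψ₁,w⁻¹|_{𝓞_w^×}` has order `∣ 8` ⇒ trivial. -/
theorem isUnramifiedAt_and_congr_of_realises {K : Type} [Field K] [NumberField K] [IsTotallyComplex K]
    (e : PadicAlgCl 3 ≃+* ℂ) {𝔪 : Ideal (𝓞 K)} (h𝔪 : 𝔪 ≠ ⊥) (h3 : 𝔪 ≤ Ideal.span {(3 : 𝓞 K)})
    {σ : K →+* ℂ} {ψ : HeightOneSpectrum (𝓞 K) → ℂ}
    (hψ : IsGrossencharakter 𝔪 (embType σ) (embTypeConj σ) ψ)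
    (η : HeckeCharacter K) (hη8 : η ^ 8 = 1)
    (hcong : ∀ v : HeightOneSpectrum (𝓞 K), ¬ 𝔪 ≤ v.asIdeal →
      ‖e.symm (ψ v) - e.symm (η.valueAtUniformizer v)‖ < 1)
    (χ : HeckeCharacter K)
    (hχ : ∀ v : HeightOneSpectrum (𝓞 K), ¬ 𝔪 ≤ v.asIdeal → χ.valueAtUniformizer v = ψ v)
    (w : HeightOneSpectrum (𝓞 K)) (hw3 : (3 : 𝓞 K) ∉ w.asIdeal) (hχw : χ.IsUnramifiedAt w) :
    η.IsUnramifiedAt w ∧ ‖e.symm (χ.valueAtUniformizer w) - e.symm (η.valueAtUniformizer w)‖ < 1 := by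
  sorry

/-- **E4′** (S–M; Galois side of the transfer, used with E4 at `w ∣ q`, `q ∤ 3·d_K`).  If `ρ|_{G_K}` lands in `kˣ` and its
Teichmüller-lifted Hecke character `η` is unramified above `q`, and `K/ℚ` is unramified at `q`, then `ρ` is unramified at `q`. -/
theorem isUnramifiedAt_of_heckeTeichmuller {K : Type} [Field K] [NumberField K]
    (ρ : ModPGaloisRep ℚ (ZMod 3) 2) {k : Subalgebra (ZMod 3) (Matrix (Fin 2) (Fin 2) (ZMod 3))} (hk : IsField k)
    (hKU : ∀ τ : absoluteGaloisGroup K, ρ (absGaloisRestrict ℚ K τ) ∈ Serre1972.unitGroup k)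
    (hrange : (absGaloisRestrict ℚ K).range = (Serre1972.unitGroup k).comap ρ.toMonoidHom)
    (j : k →+* padicAlgClResidueField 3) (e : PadicAlgCl 3 ≃+* ℂ)
    (T : padicAlgClResidueField 3 → padicAlgClIntegers 3)
    (hT : ∀ z, z ^ (3 ^ 2 - 1) = 1 →
      (T z : PadicAlgCl 3) ^ (3 ^ 2 - 1) = 1 ∧ IsLocalRing.residue (padicAlgClIntegers 3) (T z) = z)
    (η : HeckeCharacter K) (χA : FramedArtinRep K 1)
    (hdet : ∀ τ : absoluteGaloisGroup K, ((FramedRep.det χA τ : ℂˣ) : ℂ) =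
      e (T (j ⟨(ρ (absGaloisRestrict ℚ K τ) : Matrix (Fin 2) (Fin 2) (ZMod 3)), hKU τ⟩)))
    (hηχ : ∀ v : HeightOneSpectrum (𝓞 K), η.IsUnramifiedAt v ↔ χA.IsUnramifiedAt v)
    (q : ℕ) [Fact q.Prime] (hqK : Algebra.IsUnramifiedIn (𝓞 K) (Ideal.span {(q : 𝓞 ℚ)}))
    (hηq : ∀ w : HeightOneSpectrum (𝓞 K), (q : 𝓞 K) ∈ w.asIdeal → η.IsUnramifiedAt w)
    (v : HeightOneSpectrum (𝓞 ℚ)) (hv : (q : 𝓞 ℚ) ∈ v.asIdeal) :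
    ρ.IsUnramifiedAt v := by
  sorry

end Summit.ABC.ABC.Cruxes.FreyModularity.Sketch.StubCriticModThreeG2
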